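import Summits.BirchSwinnertonDyer.BirchSwinnertonDyer.Theorems.AdditiveKolyvaginRoadLevelKolyvaginSystemsAdditiveGammaLocus
import Summits.BirchSwinnertonDyer.BirchSwinnertonDyer.Theorems.AdditiveKolyvaginRoadLevelKolyvaginSystemsAdditiveStubTamagawaOffP
import Summits.BirchSwinnertonDyer.BirchSwinnertonDyer.Theorems.AdditiveKolyvaginRoadLevelKolyvaginSystemsAdditiveStubKummerLineAtP
import HarnessLib

/-!
# Route `AdditiveKolyvaginRoad`, crux KS′ `LevelKolyvaginSystemsAdditive` (item stmt-BirchSwinnertonDyer-21396): the (γ)-avatar fibre of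
# line `epsilon_matched_retyping` with BOTH local socket binders discharged — (Tam) by `stub_tamagawaOffP` (w3 g4, p606147) and (θK)ₚ by
# `stub_kummerLineAtP` (w2 g3/g4, p610049) — i.e. the line's residue on that locus is EXACTLY the lender's level system `S₀` plus the four
# displayed published inputs (cell `pub/bsd-wall`, width seat `bsd-wall-akr-p2x-w2` g4; `--supports stmt-BirchSwinnertonDyer-21396`, helper)

WHY. `nonempty_levelKolyvaginSystemP_on_gammaLocus'` (v2, w3 g4) still takes the binder `hKumP` (E's and E₀'s Kummer conditions identified
under every `Γ_K`-equivariant `θ` at the places above `p`). That binder is now the registered stub `stub_kummerLineAtP`, landed; this file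
plugs it, so the skeleton's composition `LevelKolyvaginSystemsAdditive_of` on the (γ)-branch may call ONE theorem whose remaining
non-frame inputs are: `hKL` (Kriz–Li 1.16), the `p`-parity theorem for `E` and `E₀`, Cassels–Tate over `ℚ`, Poitou–Tate over `ℚ`
(the four conjuncts of stub S0) and the LENDER's system `S₀` (stubs S5a/S5b/S5c).

* `nonempty_levelKolyvaginSystemP_on_gammaLocus_of_lender` — v2 with `hKumP` discharged (`p` splits in `K`: `p ∣ N_E` + Heegner hypothesis).

HONEST FRAMING: one theorem; 0 definitions, 0 named facts, 0 `sorry`; CONDITIONAL on the displayed named facts exactly as the line is.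
Closes nothing by itself (the lender's system `S₀` is the open input); BSD is not proved by any of this; KS′ is not proved.

References: [cite: KrizLi2019, Thm. 1.16] [cite: WZhang2014, Thm. 4.3, §9] [cite: DokchitserDokchitserAnnals2010, Thm. 1.4]
[cite: MilneADT2006, Ch. I Thm. 4.10, §6].
-/

set_option linter.dupNamespace false -- single-conjunct summit repeats the name by design
set_option autoImplicit false

noncomputable section

open scoped Classical

namespace Summit.BirchSwinnertonDyer.BirchSwinnertonDyer.Theorems.AdditiveKoly

open WeierstrassCurve NumberField IsDedekindDomain Field
  Literature.NumberTheory.EllipticCurves Literature.NumberTheory.EllipticCurves.ModularForms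
  Literature.NumberTheory.EllipticCurves.Rank1Residual Literature.NumberTheory.GaloisRepresentations
  Literature.NumberTheory.GaloisCohomology Module Summit.BirchSwinnertonDyer.Rank1Residual

variable (W W₀ : WeierstrassCurve ℚ) (K : Type) [Field K] [NumberField K] (p : ℕ)
  [W.IsGloballyMinimal] [W₀.IsGloballyMinimal] (c : K ≃ₐ[ℚ] K)
  [Module (ZMod p) (Vp W K p)] [Module (ZMod p) (Vp W₀ K p)]
  [W.IsElliptic] [W₀.IsElliptic] [hp : Fact p.Prime] [NeZero (W.conductorNorm ℤ)] [NeZero (W₀.conductorNorm ℤ)]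

/-- **THE (γ)-AVATAR FIBRE OF KS′ WITH THE E-SIDE SOCKET CLOSED.** Frame `E = W` (additive at `p ≥ 5`, `ρ̄` onto, `K` imaginary quadratic,
`d_K < −4`, Heegner for `N_E`, `4N_E ∣ β² − d_K`, `p ∤ c(Dt)`, `p ∤ ∏ c(E)`), avatar `E₀ = W₀` (Γ_ℚ-iso `e : E[p] ≃ E₀[p]`, good
non-anomalous at `p`, `hrad`, `htype`, `hsign`, `w(E₀) = w(E)`, Heegner for `N₀`, `p ∤ c(Dt₀)`, `p ∤ ∏ c(E₀)`, the log certificate along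
`ιp`), the four displayed published inputs (`p`-parity for `E` and `E₀`, Cassels–Tate over `ℚ`, Poitou–Tate over `ℚ`, Kriz–Li 1.16) and a
level Kolyvagin system `S₀` of the LENDER ⟹ `LevelKolyvaginSystemP W K p Dt β ι c` is inhabited. (= v2 `…_on_gammaLocus'` with (θK)ₚ
supplied by `stub_kummerLineAtP`; `p` splits in `K` since `p ∣ N_E`.) [cite: KrizLi2019, Thm. 1.16] [cite: WZhang2014, Thm. 4.3, §9]
[cite: DokchitserDokchitserAnnals2010, Thm. 1.4] [cite: MilneADT2006, Ch. I Thm. 4.10] -/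
theorem nonempty_levelKolyvaginSystemP_on_gammaLocus_of_lender (hKL : KrizLi2019.thm116_padicLogHeegner_congruence)
    (hparW : p_parity W p) (hparW₀ : p_parity W₀ p) (hCT : WeierstrassCurve.exists_casselsTate_pairing (K := ℚ))
    (hPT : poitouTate_selmerStructure_duality ℚ)
    (Dt : ModularParametrizationData W (W.conductorNorm ℤ)) (β : ℤ) (ι : K →+* ℂ)
    (hp5 : 5 ≤ p) (hadd : Addv W p) (hs : W.HasSurjectiveModNGaloisRep p)
    (hK : IsImaginaryQuadratic K) (hlt : NumberField.discr K < -4) (hH : SatisfiesHeegnerHypothesis (W.conductorNorm ℤ) K)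
    (hβ : (4 * (W.conductorNorm ℤ : ℤ)) ∣ β ^ 2 - NumberField.discr K) (hc : ¬ (p : ℤ) ∣ Dt.c) (htam : ¬ p ∣ W.tamagawaProduct)
    (e : geomTorsion W (p : ℤ) ≃+ geomTorsion W₀ (p : ℤ))
    (he : ∀ (σ : absoluteGaloisGroup ℚ) (T : geomTorsion W (p : ℤ)), e (σ • T) = σ • e T)
    (hgood₀ : W₀.HasGoodReductionAtPrime p) (hna : ¬ (p : ℤ) ∣ W₀.frobeniusTrace p - 1)
    (hrad : ∀ q : ℕ, q.Prime → (q ∣ p * W.conductorNorm ℤ ↔ q ∣ p * W₀.conductorNorm ℤ))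
    (htype : ∀ (ℓ : ℕ) [Fact ℓ.Prime], W.HasMultiplicativeReductionAtPrime ℓ ↔ W₀.HasMultiplicativeReductionAtPrime ℓ)
    (hsign : ∀ (ℓ : ℕ) [Fact ℓ.Prime], W₀.HasMultiplicativeReductionAtPrime ℓ → W.LFunction ℓ = W₀.LFunction ℓ)
    (hroot : W₀.rootNumber = W.rootNumber)
    (Dt₀ : ModularParametrizationData W₀ (W₀.conductorNorm ℤ)) (β₀ : ℤ) (hc₀ : ¬ (p : ℤ) ∣ Dt₀.c)
    (hH₀ : SatisfiesHeegnerHypothesis (W₀.conductorNorm ℤ) K) (htam₀ : ¬ p ∣ W₀.tamagawaProduct) (ιp : K →+* ℚ_[p])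
    (S₀ : LevelKolyvaginSystemP W₀ K p Dt₀ β₀ ι c)
    (hcert : ∃ (H₀ : HeegnerDatum (W₀.conductorNorm ℤ) (NumberField.discr K)) (y₀ : (W₀.baseChange K).toAffine.Point),
      WeierstrassCurve.Affine.Point.map ι.toRatAlgHom y₀ = heegnerPointComplex Dt₀ H₀ ∧
        ¬ ∃ Q : (W₀.baseChange ℚ_[p]).toAffine.Point, (p : ℤ) • Q = X11b.padicPointOf W₀ p ιp y₀) :
    Nonempty (LevelKolyvaginSystemP W K p Dt β ι c) := by
  -- `p` splits in `K`: `p ∣ N_E` (additive reduction) and `K` is Heegner for `N_E`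
  have hsplit : ((Ideal.span {(p : ℤ)}).primesOver (𝓞 K)).ncard = 2 :=
    hH p hp.out ((W.dvd_conductorNorm_iff_not_hasGoodReductionAtPrime p).mpr hadd.1)
  exact nonempty_levelKolyvaginSystemP_on_gammaLocus' W W₀ K p c hKL Dt β ι hp5 hadd hs hK hlt hH hβ hc htam e he hgood₀ hna hrad
    htype hsign Dt₀ β₀ hc₀ hH₀ htam₀ ιp S₀
    (fun θ hθ v hvp y ↦ stub_kummerLineAtP W W₀ p K hparW hparW₀ hCT hPT hp5 hs htam htam₀ hrad hgood₀ hna hroot hK hsplit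
      e he θ hθ v hvp y)
    hcert

end Summit.BirchSwinnertonDyer.BirchSwinnertonDyer.Theorems.AdditiveKoly

end
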